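import Mathlib
import Summits.Ventures.PercRepro2.Defs
import Summits.Ventures.PercRepro2.Harris
import Summits.Ventures.PercRepro2.Graph
import Summits.Ventures.PercRepro2.Events
import Summits.Ventures.PercRepro2.Induced
import Summits.Ventures.PercRepro2.BHKEvents
import Summits.Ventures.PercRepro2.BHKAvoid
import Summits.Ventures.PercRepro2.BHKAvoidWeighted

/-!
# The pair form of row 2′BETA1 is at least its contain-conditioned covariance (PercRepro2, p2)

Conditionally on `Q = {s ↮ t}` (`μ = P(· | Q)`; roles `s = a₂`, `t = a₁`, so `C_s = H` and
`C_t = L`), the **pair form** of the cell's line (PM) ⟸ (PM⁺) ⟸ (PM⁺-pair)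
(proofs/P2-G13-PMPLUS.md §7, proofs/P2-G14-PAIRSPLIT.md) is

  `P_LH = Cov_μ(1[b ∈ C_t], 1[u ∈ C_s]·(1[o ∈ C_s ∪ C_t] − μ(o ∈ C_s ∪ C_t)) − 1[o ∈ C_s])`.

Its numerator `N = P_LH · P(Q)³` is a cubic form in the pattern masses; with `B = {b ∈ C_t}`,
`O = {o ∈ C_s}`, `O' = {o ∈ C_t}`, `U = {s ↔ u}`, `q = P(Q)`,
`N = q²·(P(B,U,O',Q) + P(B,O,Q,U) − P(B,O,Q)) − q·(P(O',Q) + P(O,Q))·P(U,B,Q)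
 − q·P(B,Q)·(P(U,O',Q) + P(O,U,Q) − P(O,Q)) + P(B,Q)·(P(O',Q) + P(O,Q))·P(U,Q)`
(written out in the statements below; definition-free on purpose).  The law of total covariance
over the partition `{u ∈ C_s}, {u ∉ C_s}` gives the EXACT decomposition

  `P_LH = α·Cov_μ(1[b ∈ C_t], 1[o ∈ C_t] | u ∈ C_s)
        + (1 − α)·(−Cov_μ(1[b ∈ C_t], 1[o ∈ C_s] | u ∉ C_s))
        + α(1 − α)·(μ(b ∈ C_t | u ∉ C_s) − μ(b ∈ C_t | u ∈ C_s))
                 ·([μ(o ∈ C_t) − μ(o ∈ C_t | u ∈ C_s)] + [μ(o ∈ C_s) − μ(o ∈ C_s | u ∉ C_s)])`,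

`α = μ(u ∈ C_s)`, in which the second and third summands are nonnegative by four instances of
van den Berg–Häggström–Kahn (2006): `bhk_cross_cluster_avoid` (avoid set `{t, u}`), two plain
`bhk_cross_cluster` and one `bhk_same_cluster_events`.  Only the first summand — the positive
association of the two `C_t`-events `b ∈ C_t`, `o ∈ C_t` CONDITIONED ON CONTAINING `u` in `C_s` —
is not a BHK instance (contain-conditioned cluster laws are not positively associated in
general).  Cleared of denominators, with `T_c = P(b ∈ C_t, o ∈ C_t, u ∈ C_s, Q)·P(u ∈ C_s, Q)
− P(b ∈ C_t, u ∈ C_s, Q)·P(o ∈ C_t, u ∈ C_s, Q)`: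

  `P(Q)²·P(u ∉ C_s, Q)·T_c ≤ N · P(u ∈ C_s, Q) · P(u ∉ C_s, Q)`   (`pairForm_mul_ge_contain`),

through the identity `N·aH·aN − q²·aN·T_c = q²·aH·S₁ + aN·S₂·S₃ + aH·S₂·S₄` in the four BHK
slacks (`contain_reduction_identity`), and hence the reduction of record of this seat:

  `0 ≤ T_c → 0 ≤ N`   (`pairForm_nonneg_of_contain_nonneg`),

i.e. (PM⁺-pair) holds on every instance on which `Cov_μ(1[b ∈ C_t], 1[o ∈ C_t] | u ∈ C_s) ≥ 0`
(degenerate cases included) — the exact form of the obstruction of this line (P2-G13-PMPLUS §9,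
P2-G14-PAIRSPLIT §6; the defect is negative on 6 / 600 random extreme-weight instances at `n ≤ 6`
and then below 0.8 % of the slack, proofs/P2-G15-GENPLUS.md §5).
-/

namespace Summit.Ventures.PercRepro2

section PairFormContain

variable {V : Type*} {E : Type*} [Fintype E] [DecidableEq E] [Fintype V] [DecidableEq V]
  {R : Type*} [CommRing R] [LinearOrder R] [IsStrictOrderedRing R]

omit [Fintype E] [DecidableEq E] [Fintype V] [DecidableEq V] [LinearOrder R]
  [IsStrictOrderedRing R] in
/-- The algebra of the contain reduction: with the splits `q = aH + aN`, `bA = bH + bN`,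
`oH = oHH + oHN`, `bLoH = bLoHH + bLoHN`, the pair-form numerator
`N = q²(bLoLH + bLoHH − bLoH) − q(oL + oH)bH − q·bA(oLH + oHH − oH) + bA(oL + oH)aH` satisfies
`N·aH·aN − q²·aN·(bLoLH·aH − bH·oLH) = q²·aH·S₁ + aN·S₂·S₃ + aH·S₂·S₄` with the four BHK slacks
`S₁ = oHN·bN − bLoHN·aN`, `S₂ = bN·aH − bH·aN`, `S₃ = oL·aH − oLH·q`, `S₄ = oH·aN − oHN·q`. -/
lemma contain_reduction_identity {q aH aN bA bH bN oL oLH oH oHH oHN bLoLH bLoHH bLoHN bLoH : R}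
    (hq : q = aH + aN) (hb : bA = bH + bN) (ho : oH = oHH + oHN) (hbo : bLoH = bLoHH + bLoHN) :
    (q * q * (bLoLH + bLoHH - bLoH) - q * (oL + oH) * bH - q * bA * (oLH + oHH - oH)
        + bA * (oL + oH) * aH) * aH * aN - q * q * aN * (bLoLH * aH - bH * oLH) =
      q * q * aH * (oHN * bN - bLoHN * aN) + aN * (bN * aH - bH * aN) * (oL * aH - oLH * q)
        + aH * (bN * aH - bH * aN) * (oH * aN - oHN * q) := by
  subst hq hb ho hbo
  ring

omit [Fintype E] [DecidableEq E] [Fintype V] [DecidableEq V] in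
/-- The contain reduction, algebraic form: from the four BHK instances
`bLoHN·aN ≤ oHN·bN` (cross clusters, avoiding `u`), `bH·q ≤ aH·bA` (cross clusters),
`oLH·q ≤ aH·oL` (cross clusters), `oH·aH ≤ oHH·q` (same cluster) and the splits,
`q²·aN·(bLoLH·aH − bH·oLH) ≤ N·aH·aN`. -/
lemma contain_reduction_algebra {q aH aN bA bH bN oL oLH oH oHH oHN bLoLH bLoHH bLoHN bLoH : R}
    (haH : 0 ≤ aH) (haN : 0 ≤ aN)
    (hq : q = aH + aN) (hb : bA = bH + bN) (ho : oH = oHH + oHN) (hbo : bLoH = bLoHH + bLoHN)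
    (h1 : bLoHN * aN ≤ oHN * bN) (h2 : bH * q ≤ aH * bA) (h3 : oLH * q ≤ aH * oL)
    (h4 : oH * aH ≤ oHH * q) :
    q * q * aN * (bLoLH * aH - bH * oLH) ≤
      (q * q * (bLoLH + bLoHH - bLoH) - q * (oL + oH) * bH - q * bA * (oLH + oHH - oH)
        + bA * (oL + oH) * aH) * aH * aN := by
  have key := contain_reduction_identity hq hb ho hbo (oL := oL) (oLH := oLH) (bLoLH := bLoLH)
  have hS1 : 0 ≤ oHN * bN - bLoHN * aN := by linarith
  have hS2 : 0 ≤ bN * aH - bH * aN := by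
    have : bH * (aH + aN) ≤ aH * (bH + bN) := by rw [← hq, ← hb]; exact h2
    linarith
  have hS3 : 0 ≤ oL * aH - oLH * q := by linarith
  have hS4 : 0 ≤ oH * aN - oHN * q := by
    have : (oHH + oHN) * aH ≤ oHH * (aH + aN) := by rw [← ho, ← hq]; exact h4
    rw [ho, hq]; linarith
  have hq0 : 0 ≤ q := by rw [hq]; exact add_nonneg haH haN
  have t1 : 0 ≤ q * q * aH * (oHN * bN - bLoHN * aN) :=
    mul_nonneg (mul_nonneg (mul_nonneg hq0 hq0) haH) hS1
  have t2 : 0 ≤ aN * (bN * aH - bH * aN) * (oL * aH - oLH * q) :=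
    mul_nonneg (mul_nonneg haN hS2) hS3
  have t3 : 0 ≤ aH * (bN * aH - bH * aN) * (oH * aN - oHN * q) :=
    mul_nonneg (mul_nonneg haH hS2) hS4
  linarith

omit [Fintype E] [DecidableEq E] [Fintype V] [DecidableEq V] [LinearOrder R]
  [IsStrictOrderedRing R] in
/-- The degenerate case `P(u ∉ C_s, Q) = 0`: every mass with `u ∉ C_s` vanishes and the numerator
collapses to `q · (bLoLH·aH − bH·oLH)`. -/
lemma contain_reduction_degenerate {q aH aN bA bH bN oL oLH oH oHH oHN bLoLH bLoHH bLoHN bLoH : R}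
    (hq : q = aH + aN) (hb : bA = bH + bN) (ho : oH = oHH + oHN) (hbo : bLoH = bLoHH + bLoHN)
    (haN : aN = 0) (hbN : bN = 0) (hoHN : oHN = 0) (hbLoHN : bLoHN = 0) :
    q * q * (bLoLH + bLoHH - bLoH) - q * (oL + oH) * bH - q * bA * (oLH + oHH - oH)
        + bA * (oL + oH) * aH = q * (bLoLH * aH - bH * oLH) := by
  subst hq hb ho hbo haN hbN hoHN hbLoHN
  ring

omit [Fintype E] [DecidableEq E] [Fintype V] [DecidableEq V] [LinearOrder R]
  [IsStrictOrderedRing R] in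
/-- The degenerate case `P(u ∈ C_s, Q) = 0`: every mass with `u ∈ C_s` vanishes and the numerator
collapses to `q · (bA·oH − q·bLoH)`, the cross-cluster BHK slack of `(b ∈ C_t, o ∈ C_s)`. -/
lemma contain_reduction_degenerate' {q aH bA bH oL oLH oH oHH bLoLH bLoHH bLoH : R}
    (haH : aH = 0) (hbH : bH = 0) (hoLH : oLH = 0) (hoHH : oHH = 0) (hbLoLH : bLoLH = 0)
    (hbLoHH : bLoHH = 0) :
    q * q * (bLoLH + bLoHH - bLoH) - q * (oL + oH) * bH - q * bA * (oLH + oHH - oH)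
        + bA * (oL + oH) * aH = q * (bA * oH - q * bLoH) := by
  subst haH hbH hoLH hoHH hbLoLH hbLoHH
  ring

/-- **The contain reduction of the pair form** (multiplied out): with `q = P(Q)`,
`aH = P(u ∈ C_s, Q)`, `aN = P(u ∉ C_s, Q)`, `N = P_LH·q³` (the second factor of the right side,
see the module docstring) and `T_c = P(B, U, O', Q)·P(U, Q) − P(U, B, Q)·P(U, O', Q)`
(`= Cov_μ(1[b ∈ C_t], 1[o ∈ C_t] | u ∈ C_s)·P(U, Q)²`, the last factor of the left side):
`q²·aN·T_c ≤ N·aH·aN`; the difference is `q²·aH·S₁ + aN·S₂·S₃ + aH·S₂·S₄` in the four BHK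
slacks of the module docstring. -/
theorem pairForm_mul_ge_contain (p : E → R) (hp : IsProbVec p) (ends : E → Sym2 V)
    (s t u o b : V) :
    prob p (connEvent ends s t)ᶜ * prob p (connEvent ends s t)ᶜ *
        prob p ((connEvent ends s t)ᶜ ∩ (connEvent ends s u)ᶜ) *
        (prob p (clusterInEvent ends t {W : Set V | b ∈ W} ∩ connEvent ends s u ∩
            clusterInEvent ends t {W : Set V | o ∈ W} ∩ (connEvent ends s t)ᶜ) *
          prob p (connEvent ends s u ∩ (connEvent ends s t)ᶜ) -
        prob p (connEvent ends s u ∩ clusterInEvent ends t {W : Set V | b ∈ W} ∩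
            (connEvent ends s t)ᶜ) *
          prob p (connEvent ends s u ∩ clusterInEvent ends t {W : Set V | o ∈ W} ∩
            (connEvent ends s t)ᶜ)) ≤
      (prob p (connEvent ends s t)ᶜ * prob p (connEvent ends s t)ᶜ *
          (prob p (clusterInEvent ends t {W : Set V | b ∈ W} ∩ connEvent ends s u ∩
              clusterInEvent ends t {W : Set V | o ∈ W} ∩ (connEvent ends s t)ᶜ) +
            prob p (clusterInEvent ends t {W : Set V | b ∈ W} ∩
              clusterInEvent ends s {W : Set V | o ∈ W} ∩ (connEvent ends s t)ᶜ ∩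
              connEvent ends s u) -
            prob p (clusterInEvent ends t {W : Set V | b ∈ W} ∩
              clusterInEvent ends s {W : Set V | o ∈ W} ∩ (connEvent ends s t)ᶜ)) -
        prob p (connEvent ends s t)ᶜ *
          (prob p (clusterInEvent ends t {W : Set V | o ∈ W} ∩ (connEvent ends s t)ᶜ) +
            prob p (clusterInEvent ends s {W : Set V | o ∈ W} ∩ (connEvent ends s t)ᶜ)) *
          prob p (connEvent ends s u ∩ clusterInEvent ends t {W : Set V | b ∈ W} ∩
            (connEvent ends s t)ᶜ) -
        prob p (connEvent ends s t)ᶜ *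
          prob p (clusterInEvent ends t {W : Set V | b ∈ W} ∩ (connEvent ends s t)ᶜ) *
          (prob p (connEvent ends s u ∩ clusterInEvent ends t {W : Set V | o ∈ W} ∩
              (connEvent ends s t)ᶜ) +
            prob p (clusterInEvent ends s {W : Set V | o ∈ W} ∩ connEvent ends s u ∩
              (connEvent ends s t)ᶜ) -
            prob p (clusterInEvent ends s {W : Set V | o ∈ W} ∩ (connEvent ends s t)ᶜ)) +
        prob p (clusterInEvent ends t {W : Set V | b ∈ W} ∩ (connEvent ends s t)ᶜ) *
          (prob p (clusterInEvent ends t {W : Set V | o ∈ W} ∩ (connEvent ends s t)ᶜ) +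
            prob p (clusterInEvent ends s {W : Set V | o ∈ W} ∩ (connEvent ends s t)ᶜ)) *
          prob p (connEvent ends s u ∩ (connEvent ends s t)ᶜ)) *
        prob p (connEvent ends s u ∩ (connEvent ends s t)ᶜ) *
        prob p ((connEvent ends s t)ᶜ ∩ (connEvent ends s u)ᶜ) := by
  classical
  have hU : clusterInEvent ends s {W : Set V | u ∈ W} = connEvent ends s u :=
    clusterInEvent_memFamily_eq_connEvent ends s u
  -- the four BHK instances
  have h1 := bhk_cross_cluster_avoid p hp ends s t (X := {t, u}) (by simp)
    (isUpperSet_memFamily o) (isUpperSet_memFamily b)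
  rw [avoidAll_pair] at h1
  have h2 := bhk_cross_cluster p hp ends s t (isUpperSet_memFamily u) (isUpperSet_memFamily b)
  rw [hU] at h2
  have h3 := bhk_cross_cluster p hp ends s t (isUpperSet_memFamily u) (isUpperSet_memFamily o)
  rw [hU] at h3
  have h4 := bhk_same_cluster_events p hp ends s t (isUpperSet_memFamily o)
    (isUpperSet_memFamily u)
  rw [hU] at h4
  -- the splits over `{s ↔ u}` / `{s ↮ u}`
  have hq := prob_inter_add_prob_inter_compl p (connEvent ends s t)ᶜ (connEvent ends s u)
  have eq1 : (connEvent ends s t)ᶜ ∩ connEvent ends s u =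
      connEvent ends s u ∩ (connEvent ends s t)ᶜ := Set.inter_comm _ _
  rw [eq1] at hq
  have hb := prob_inter_add_prob_inter_compl p
    (clusterInEvent ends t {W : Set V | b ∈ W} ∩ (connEvent ends s t)ᶜ) (connEvent ends s u)
  have eb1 : clusterInEvent ends t {W : Set V | b ∈ W} ∩ (connEvent ends s t)ᶜ ∩
      connEvent ends s u =
      connEvent ends s u ∩ clusterInEvent ends t {W : Set V | b ∈ W} ∩ (connEvent ends s t)ᶜ := by
    ext ω; simp only [Set.mem_inter_iff]; tauto
  have eb2 : clusterInEvent ends t {W : Set V | b ∈ W} ∩ (connEvent ends s t)ᶜ ∩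
      (connEvent ends s u)ᶜ =
      clusterInEvent ends t {W : Set V | b ∈ W} ∩
        ((connEvent ends s t)ᶜ ∩ (connEvent ends s u)ᶜ) := Set.inter_assoc _ _ _
  rw [eb1, eb2] at hb
  have ho := prob_inter_add_prob_inter_compl p
    (clusterInEvent ends s {W : Set V | o ∈ W} ∩ (connEvent ends s t)ᶜ) (connEvent ends s u)
  have eo1 : clusterInEvent ends s {W : Set V | o ∈ W} ∩ (connEvent ends s t)ᶜ ∩
      connEvent ends s u =
      clusterInEvent ends s {W : Set V | o ∈ W} ∩ connEvent ends s u ∩ (connEvent ends s t)ᶜ := by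
    ext ω; simp only [Set.mem_inter_iff]; tauto
  have eo2 : clusterInEvent ends s {W : Set V | o ∈ W} ∩ (connEvent ends s t)ᶜ ∩
      (connEvent ends s u)ᶜ =
      clusterInEvent ends s {W : Set V | o ∈ W} ∩
        ((connEvent ends s t)ᶜ ∩ (connEvent ends s u)ᶜ) := Set.inter_assoc _ _ _
  rw [eo1, eo2] at ho
  have hbo := prob_inter_add_prob_inter_compl p
    (clusterInEvent ends t {W : Set V | b ∈ W} ∩ clusterInEvent ends s {W : Set V | o ∈ W} ∩
      (connEvent ends s t)ᶜ) (connEvent ends s u)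
  have ebo2 : clusterInEvent ends t {W : Set V | b ∈ W} ∩ clusterInEvent ends s {W : Set V | o ∈ W} ∩
      (connEvent ends s t)ᶜ ∩ (connEvent ends s u)ᶜ =
      clusterInEvent ends s {W : Set V | o ∈ W} ∩ clusterInEvent ends t {W : Set V | b ∈ W} ∩
        ((connEvent ends s t)ᶜ ∩ (connEvent ends s u)ᶜ) := by
    ext ω; simp only [Set.mem_inter_iff, Set.mem_compl_iff]; tauto
  rw [ebo2] at hbo
  exact contain_reduction_algebra (prob_nonneg hp _) (prob_nonneg hp _) hq.symm hb.symm ho.symm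
    hbo.symm h1 h2 h3 h4

/-- **The reduction of record: (PM⁺-pair) ⟸ contain-conditioned positive association.**
If `Cov_μ(1[b ∈ C_t], 1[o ∈ C_t] | u ∈ C_s) ≥ 0` (`0 ≤ T_c`, the hypothesis) then the pair form of
row 2′BETA1 is nonnegative (`0 ≤ N = P_LH·P(Q)³`, i.e. `P_LH ≥ 0` whenever `P(Q) > 0`); the
degenerate cases `P(u ∈ C_s, Q) = 0` (then `N = q·(P(B,Q)·P(O,Q) − q·P(B,O,Q)) ≥ 0`, BHK cross
clusters) and `P(u ∉ C_s, Q) = 0` (then `N = q·T_c`) included. -/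
theorem pairForm_nonneg_of_contain_nonneg (p : E → R) (hp : IsProbVec p)
    (ends : E → Sym2 V) (s t u o b : V)
    (hc : 0 ≤ (prob p (clusterInEvent ends t {W : Set V | b ∈ W} ∩ connEvent ends s u ∩
            clusterInEvent ends t {W : Set V | o ∈ W} ∩ (connEvent ends s t)ᶜ) *
          prob p (connEvent ends s u ∩ (connEvent ends s t)ᶜ) -
        prob p (connEvent ends s u ∩ clusterInEvent ends t {W : Set V | b ∈ W} ∩
            (connEvent ends s t)ᶜ) *
          prob p (connEvent ends s u ∩ clusterInEvent ends t {W : Set V | o ∈ W} ∩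
            (connEvent ends s t)ᶜ))) :
    0 ≤ (prob p (connEvent ends s t)ᶜ * prob p (connEvent ends s t)ᶜ *
          (prob p (clusterInEvent ends t {W : Set V | b ∈ W} ∩ connEvent ends s u ∩
              clusterInEvent ends t {W : Set V | o ∈ W} ∩ (connEvent ends s t)ᶜ) +
            prob p (clusterInEvent ends t {W : Set V | b ∈ W} ∩
              clusterInEvent ends s {W : Set V | o ∈ W} ∩ (connEvent ends s t)ᶜ ∩
              connEvent ends s u) -
            prob p (clusterInEvent ends t {W : Set V | b ∈ W} ∩
              clusterInEvent ends s {W : Set V | o ∈ W} ∩ (connEvent ends s t)ᶜ)) -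
        prob p (connEvent ends s t)ᶜ *
          (prob p (clusterInEvent ends t {W : Set V | o ∈ W} ∩ (connEvent ends s t)ᶜ) +
            prob p (clusterInEvent ends s {W : Set V | o ∈ W} ∩ (connEvent ends s t)ᶜ)) *
          prob p (connEvent ends s u ∩ clusterInEvent ends t {W : Set V | b ∈ W} ∩
            (connEvent ends s t)ᶜ) -
        prob p (connEvent ends s t)ᶜ *
          prob p (clusterInEvent ends t {W : Set V | b ∈ W} ∩ (connEvent ends s t)ᶜ) *
          (prob p (connEvent ends s u ∩ clusterInEvent ends t {W : Set V | o ∈ W} ∩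
              (connEvent ends s t)ᶜ) +
            prob p (clusterInEvent ends s {W : Set V | o ∈ W} ∩ connEvent ends s u ∩
              (connEvent ends s t)ᶜ) -
            prob p (clusterInEvent ends s {W : Set V | o ∈ W} ∩ (connEvent ends s t)ᶜ)) +
        prob p (clusterInEvent ends t {W : Set V | b ∈ W} ∩ (connEvent ends s t)ᶜ) *
          (prob p (clusterInEvent ends t {W : Set V | o ∈ W} ∩ (connEvent ends s t)ᶜ) +
            prob p (clusterInEvent ends s {W : Set V | o ∈ W} ∩ (connEvent ends s t)ᶜ)) *
          prob p (connEvent ends s u ∩ (connEvent ends s t)ᶜ)) := by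
  classical
  have main := pairForm_mul_ge_contain p hp ends s t u o b
  have hq0 : 0 ≤ prob p (connEvent ends s t)ᶜ := prob_nonneg hp _
  have haH0 : 0 ≤ prob p (connEvent ends s u ∩ (connEvent ends s t)ᶜ) := prob_nonneg hp _
  have haN0 : 0 ≤ prob p ((connEvent ends s t)ᶜ ∩ (connEvent ends s u)ᶜ) := prob_nonneg hp _
  rcases haN0.lt_or_eq with haNpos | haNzero
  · rcases haH0.lt_or_eq with haHpos | haHzero
    · -- the generic case: divide by `aH·aN > 0`
      have hlhs : 0 ≤ prob p (connEvent ends s t)ᶜ * prob p (connEvent ends s t)ᶜ *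
          prob p ((connEvent ends s t)ᶜ ∩ (connEvent ends s u)ᶜ) *
          (prob p (clusterInEvent ends t {W : Set V | b ∈ W} ∩ connEvent ends s u ∩
            clusterInEvent ends t {W : Set V | o ∈ W} ∩ (connEvent ends s t)ᶜ) *
          prob p (connEvent ends s u ∩ (connEvent ends s t)ᶜ) -
        prob p (connEvent ends s u ∩ clusterInEvent ends t {W : Set V | b ∈ W} ∩
            (connEvent ends s t)ᶜ) *
          prob p (connEvent ends s u ∩ clusterInEvent ends t {W : Set V | o ∈ W} ∩
            (connEvent ends s t)ᶜ)) :=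
        mul_nonneg (mul_nonneg (mul_nonneg hq0 hq0) haN0) hc
      have hprod : 0 ≤ (prob p (connEvent ends s t)ᶜ * prob p (connEvent ends s t)ᶜ *
          (prob p (clusterInEvent ends t {W : Set V | b ∈ W} ∩ connEvent ends s u ∩
              clusterInEvent ends t {W : Set V | o ∈ W} ∩ (connEvent ends s t)ᶜ) +
            prob p (clusterInEvent ends t {W : Set V | b ∈ W} ∩
              clusterInEvent ends s {W : Set V | o ∈ W} ∩ (connEvent ends s t)ᶜ ∩
              connEvent ends s u) -
            prob p (clusterInEvent ends t {W : Set V | b ∈ W} ∩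
              clusterInEvent ends s {W : Set V | o ∈ W} ∩ (connEvent ends s t)ᶜ)) -
        prob p (connEvent ends s t)ᶜ *
          (prob p (clusterInEvent ends t {W : Set V | o ∈ W} ∩ (connEvent ends s t)ᶜ) +
            prob p (clusterInEvent ends s {W : Set V | o ∈ W} ∩ (connEvent ends s t)ᶜ)) *
          prob p (connEvent ends s u ∩ clusterInEvent ends t {W : Set V | b ∈ W} ∩
            (connEvent ends s t)ᶜ) -
        prob p (connEvent ends s t)ᶜ *
          prob p (clusterInEvent ends t {W : Set V | b ∈ W} ∩ (connEvent ends s t)ᶜ) *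
          (prob p (connEvent ends s u ∩ clusterInEvent ends t {W : Set V | o ∈ W} ∩
              (connEvent ends s t)ᶜ) +
            prob p (clusterInEvent ends s {W : Set V | o ∈ W} ∩ connEvent ends s u ∩
              (connEvent ends s t)ᶜ) -
            prob p (clusterInEvent ends s {W : Set V | o ∈ W} ∩ (connEvent ends s t)ᶜ)) +
        prob p (clusterInEvent ends t {W : Set V | b ∈ W} ∩ (connEvent ends s t)ᶜ) *
          (prob p (clusterInEvent ends t {W : Set V | o ∈ W} ∩ (connEvent ends s t)ᶜ) +
            prob p (clusterInEvent ends s {W : Set V | o ∈ W} ∩ (connEvent ends s t)ᶜ)) *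
          prob p (connEvent ends s u ∩ (connEvent ends s t)ᶜ)) *
          (prob p (connEvent ends s u ∩ (connEvent ends s t)ᶜ) *
            prob p ((connEvent ends s t)ᶜ ∩ (connEvent ends s u)ᶜ)) := by
        rw [← mul_assoc]; linarith
      exact nonneg_of_mul_nonneg_left hprod (mul_pos haHpos haNpos)
    · -- `P(u ∈ C_s, Q) = 0`: the masses containing `u ∈ C_s` vanish
      have hU : clusterInEvent ends s {W : Set V | u ∈ W} = connEvent ends s u :=
        clusterInEvent_memFamily_eq_connEvent ends s u
      have hcross := bhk_cross_cluster p hp ends s t (isUpperSet_memFamily o)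
        (isUpperSet_memFamily b)
      have ecross : clusterInEvent ends s {W : Set V | o ∈ W} ∩
          clusterInEvent ends t {W : Set V | b ∈ W} ∩ (connEvent ends s t)ᶜ =
          clusterInEvent ends t {W : Set V | b ∈ W} ∩ clusterInEvent ends s {W : Set V | o ∈ W} ∩
            (connEvent ends s t)ᶜ := by
        ext ω; simp only [Set.mem_inter_iff]; tauto
      rw [ecross] at hcross
      have vanish : ∀ A : Set (Config E), A ⊆ connEvent ends s u ∩ (connEvent ends s t)ᶜ →
          prob p A = 0 := fun A hA =>
        le_antisymm (haHzero ▸ prob_mono hp hA) (prob_nonneg hp A)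
      have v1 := vanish (connEvent ends s u ∩ clusterInEvent ends t {W : Set V | b ∈ W} ∩
        (connEvent ends s t)ᶜ) (fun ω hω => ⟨hω.1.1, hω.2⟩)
      have v2 := vanish (connEvent ends s u ∩ clusterInEvent ends t {W : Set V | o ∈ W} ∩
        (connEvent ends s t)ᶜ) (fun ω hω => ⟨hω.1.1, hω.2⟩)
      have v3 := vanish (clusterInEvent ends s {W : Set V | o ∈ W} ∩ connEvent ends s u ∩
        (connEvent ends s t)ᶜ) (fun ω hω => ⟨hω.1.2, hω.2⟩)
      have v4 := vanish (clusterInEvent ends t {W : Set V | b ∈ W} ∩ connEvent ends s u ∩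
        clusterInEvent ends t {W : Set V | o ∈ W} ∩ (connEvent ends s t)ᶜ)
        (fun ω hω => ⟨hω.1.1.2, hω.2⟩)
      have v5 := vanish (clusterInEvent ends t {W : Set V | b ∈ W} ∩
        clusterInEvent ends s {W : Set V | o ∈ W} ∩ (connEvent ends s t)ᶜ ∩ connEvent ends s u)
        (fun ω hω => ⟨hω.2, hω.1.2⟩)
      rw [contain_reduction_degenerate' haHzero.symm v1 v2 v3 v4 v5]
      have : prob p (connEvent ends s t)ᶜ *
          prob p (clusterInEvent ends t {W : Set V | b ∈ W} ∩
            clusterInEvent ends s {W : Set V | o ∈ W} ∩ (connEvent ends s t)ᶜ) ≤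
          prob p (clusterInEvent ends t {W : Set V | b ∈ W} ∩ (connEvent ends s t)ᶜ) *
          prob p (clusterInEvent ends s {W : Set V | o ∈ W} ∩ (connEvent ends s t)ᶜ) := by
        rw [mul_comm]; linarith [hcross]
      exact mul_nonneg hq0 (by linarith)
  · -- `P(u ∉ C_s, Q) = 0`: the masses containing `u ∉ C_s` vanish
    have hq := prob_inter_add_prob_inter_compl p (connEvent ends s t)ᶜ (connEvent ends s u)
    have eq1 : (connEvent ends s t)ᶜ ∩ connEvent ends s u =
        connEvent ends s u ∩ (connEvent ends s t)ᶜ := Set.inter_comm _ _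
    rw [eq1] at hq
    have hb := prob_inter_add_prob_inter_compl p
      (clusterInEvent ends t {W : Set V | b ∈ W} ∩ (connEvent ends s t)ᶜ) (connEvent ends s u)
    have eb1 : clusterInEvent ends t {W : Set V | b ∈ W} ∩ (connEvent ends s t)ᶜ ∩
        connEvent ends s u =
        connEvent ends s u ∩ clusterInEvent ends t {W : Set V | b ∈ W} ∩
          (connEvent ends s t)ᶜ := by
      ext ω; simp only [Set.mem_inter_iff]; tauto
    have eb2 : clusterInEvent ends t {W : Set V | b ∈ W} ∩ (connEvent ends s t)ᶜ ∩
        (connEvent ends s u)ᶜ =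
        clusterInEvent ends t {W : Set V | b ∈ W} ∩
          ((connEvent ends s t)ᶜ ∩ (connEvent ends s u)ᶜ) := Set.inter_assoc _ _ _
    rw [eb1, eb2] at hb
    have ho := prob_inter_add_prob_inter_compl p
      (clusterInEvent ends s {W : Set V | o ∈ W} ∩ (connEvent ends s t)ᶜ) (connEvent ends s u)
    have eo1 : clusterInEvent ends s {W : Set V | o ∈ W} ∩ (connEvent ends s t)ᶜ ∩
        connEvent ends s u =
        clusterInEvent ends s {W : Set V | o ∈ W} ∩ connEvent ends s u ∩
          (connEvent ends s t)ᶜ := by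
      ext ω; simp only [Set.mem_inter_iff]; tauto
    have eo2 : clusterInEvent ends s {W : Set V | o ∈ W} ∩ (connEvent ends s t)ᶜ ∩
        (connEvent ends s u)ᶜ =
        clusterInEvent ends s {W : Set V | o ∈ W} ∩
          ((connEvent ends s t)ᶜ ∩ (connEvent ends s u)ᶜ) := Set.inter_assoc _ _ _
    rw [eo1, eo2] at ho
    have hbo := prob_inter_add_prob_inter_compl p
      (clusterInEvent ends t {W : Set V | b ∈ W} ∩ clusterInEvent ends s {W : Set V | o ∈ W} ∩
        (connEvent ends s t)ᶜ) (connEvent ends s u)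
    have ebo2 : clusterInEvent ends t {W : Set V | b ∈ W} ∩
        clusterInEvent ends s {W : Set V | o ∈ W} ∩ (connEvent ends s t)ᶜ ∩
        (connEvent ends s u)ᶜ =
        clusterInEvent ends s {W : Set V | o ∈ W} ∩ clusterInEvent ends t {W : Set V | b ∈ W} ∩
          ((connEvent ends s t)ᶜ ∩ (connEvent ends s u)ᶜ) := by
      ext ω; simp only [Set.mem_inter_iff, Set.mem_compl_iff]; tauto
    rw [ebo2] at hbo
    have vanish : ∀ A : Set (Config E), A ⊆ (connEvent ends s t)ᶜ ∩ (connEvent ends s u)ᶜ →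
        prob p A = 0 := fun A hA =>
      le_antisymm (haNzero ▸ prob_mono hp hA) (prob_nonneg hp A)
    have v1 := vanish (clusterInEvent ends t {W : Set V | b ∈ W} ∩
      ((connEvent ends s t)ᶜ ∩ (connEvent ends s u)ᶜ)) (fun ω hω => hω.2)
    have v2 := vanish (clusterInEvent ends s {W : Set V | o ∈ W} ∩
      ((connEvent ends s t)ᶜ ∩ (connEvent ends s u)ᶜ)) (fun ω hω => hω.2)
    have v3 := vanish (clusterInEvent ends s {W : Set V | o ∈ W} ∩
      clusterInEvent ends t {W : Set V | b ∈ W} ∩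
      ((connEvent ends s t)ᶜ ∩ (connEvent ends s u)ᶜ)) (fun ω hω => hω.2)
    rw [contain_reduction_degenerate hq.symm hb.symm ho.symm hbo.symm haNzero.symm v1 v2 v3]
    exact mul_nonneg hq0 hc

end PairFormContain

end Summit.Ventures.PercRepro2
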